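import Summits.QuantumFields.Balaban3D.Proofs.Run3StepCumulant
import Summits.QuantumFields.Balaban3D.Proofs.ChartFromBound25

/-!
# `Balaban3D.Proofs.Run3CumulantChart` — rows C3 / C4 / B21 at `Carriers.seriesPieces B 𝔖 C k` with the display (25)
# CONSUMED ONCE (lane ruling R-ACT): the chart binder G3D-01 `Binders.ChartAnalyticityAsCited` + the (28)-bound on the
# chart configurations + its smallness give `B10.Bound25Printed` for the DEFINED activities `act h X U = Re Ψ_X(B_X(h,U))`
# (seat p6's `ChartFromBound25.bound25_real_of_chart`) and for the vacuum activities `Re Ψ_X(0)` — the SAME three inputs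
# p6's C5/C6/C7 consume, so (25) is not a separate END hypothesis of the cumulant rows

Lane «pub-balaban3d», seat p5 (WAVE 2: after `Run3StepCumulant` and p6's `ChartFromBound25`).  Three one-line compositions;
no definition, no named fact. [cite: Balaban1985UV3, (25) p.262 + (28)–(29) p.263 + (58)–(59) p.270]
-/

open MeasureTheory
open scoped BigOperators Nat

namespace Summit.QuantumFields.Balaban3D.Proofs

open Literature.MathematicalPhysics.QuantumFieldTheory.Balaban1983to89
open Literature.MathematicalPhysics.QuantumFieldTheory.Balaban1983to89.B10SectAGathering (Cumulant58 CumulantLower)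
open Literature.MathematicalPhysics.QuantumFieldTheory.Balaban1983to89.B10Eq24Cumulant (chiMeasure truncExp)
open Literature.MathematicalPhysics.QuantumFieldTheory.Balaban1983to89.B12TreeDecay (kappa₀ K₀)
open Literature.MathematicalPhysics.QuantumFieldTheory.Balaban1983to89.TreeLengthTorus (tsys tcubeSys TPt)
open Literature.MathematicalPhysics.QuantumFieldTheory.Balaban1985CMP102.Setting (Scales)
open Literature.MathematicalPhysics.QuantumFieldTheory.Balaban1985CMP102.Binders (GraphTerms GraphRep23AsCited
  ChartAnalyticityAsCited)
open Summit.QuantumFields.Balaban3D.Carriers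
open Summit.QuantumFields.Balaban3D.Proofs.ChartFromBound25 (bound25_real_of_chart)

variable {L : ℕ} {S : Scales L} {G : Type} [GaugeGroup G] [MeasurableSpace G] [HaarData G]
  {V : Type} [NormedAddCommGroup V] [NormedSpace ℂ V] {Nc : ℕ → ℕ} [∀ k, NeZero (Nc k)]

/-! ## (25) CONSUMED ONCE (ruling R-ACT): the chart binder G3D-01 + (28) + smallness give `h25` for `act` (p6
`ChartFromBound25.bound25_real_of_chart`) and for the vacuum activities at the chart origin -/

/-- **C3 `cumulant58` AT `seriesPieces` — CHART FORM** (R-ACT): `h25` REPLACED by the G3D-01 chart binder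
`chart : ∀ X, ChartAnalyticityAsCited ((𝔖 k).Ψ X) ρ (C·g_k·e^{−κ𝓛(X)})` + the (28)-bound `bound28 : ‖Bcfg X h U‖ ≤ s` +
the smallness `small28 : s ≤ ρ/4` (p6 `bound25_real_of_chart`; the SAME three inputs p6's C5/C6/C7 consume). [cite: Balaban1985UV3, (25) p.262 + (28)–(29) p.263 + (58)–(59) p.270] -/
theorem cumulant58_series_chart (B : TowerBase S G) (𝔖 : ∀ k, StepSeries S G V (Nc k) k) (Cp : ∀ k, PiecesParams S k) (k : ℕ)
    [DecidableEq (tsys 3 (𝔖 k).Nblk).Dom] [IsProbabilityMeasure (𝔖 k).μ] {κ C ρ s : ℝ}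
    (hκ : kappa₀ (4 * 2 ^ 3) (2 * 3) + 1 ≤ κ) (hC : 0 ≤ C) {C₂₃ c M₁ δ₀ : ℝ}
    (hact : ∀ h X U, ((𝔖 k).Gt h).activities.act X U = (𝔖 k).act h X U)
    (hboxm : ∀ h, MeasurableSet ((𝔖 k).box h)) (hbox : ∀ h, (𝔖 k).μ ((𝔖 k).box h) ≠ 0)
    (hVm : ∀ h U, AEMeasurable ((𝔖 k).𝒱 h U) (𝔖 k).μ) {Bv : ℝ}
    (hVB : ∀ h U, ∀ ω ∈ (𝔖 k).box h, |(𝔖 k).𝒱 h U ω| ≤ Bv) {nbar : ℕ} {Ca Cc : ℝ}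
    (h324a : ∀ h (U : GaugeField S.P (k + 1) G), |Real.log ((𝔖 k).μ.real ((𝔖 k).box h))| ≤
      Ca * ((L : ℝ) ^ k * S.g0sq) ^ (3 + B.κ₀) * S.sites k)
    (h324c : ∀ h U, ∀ t ∈ Set.Icc (0 : ℝ) 1, |iteratedDeriv (nbar + 1) (ProbabilityTheory.cgf ((𝔖 k).𝒱 h U)
        (chiMeasure (𝔖 k).μ (((𝔖 k).box h).indicator fun _ => (1 : ℝ)))) t| ≤
          Cc * ((nbar + 1)! : ℝ) * ((L : ℝ) ^ k * S.g0sq) ^ (3 + B.κ₀) * S.sites k)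
    (hCac : 0 ≤ Ca + Cc) (hk : k ≤ S.K) (hκ₀ : 0 < B.κ₀) {r₀ R₁ : ℝ} (hr₀ : 1 ≤ r₀) (hR₁ : 6 + 2 * B.κ₀ ≤ R₁)
    (hrem : (Cp k).rem = ((L : ℝ) ^ k * S.g0sq) ^ (3 + B.κ₀) * S.sites k)
    (hRret : B.Rret k = R₁ * B10.rFun r₀ (S.gk k))
    (hblocks : ((𝔖 k).Nblk : ℝ) ^ 3 ≤ S.sites k)
    (hG : ∀ h, GraphRep23AsCited ((𝔖 k).Gt h) (fun U => ∑ n ∈ Finset.Icc 1 nbar, (𝔖 k).cum h U n / (n ! : ℝ))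
      C₂₃ c M₁ δ₀)
    (chart : ∀ X, ChartAnalyticityAsCited ((𝔖 k).Ψ X) ρ (C * S.gk k * Real.exp (-(κ * (tsys 3 (𝔖 k).Nblk).dj X))))
    (bound28 : ∀ X h U, ‖(𝔖 k).Bcfg X h U‖ ≤ s) (small28 : s ≤ ρ / 4) :
    Cumulant58 (seriesPieces B 𝔖 Cp k) (C * K₀ (4 * 2 ^ 3) (2 * 3))
      (0 + C * K₀ (4 * 2 ^ 3) (2 * 3) * Real.exp (-R₁) + (Ca + 0 + Cc)) :=
  cumulant58_series_std B 𝔖 Cp k hκ hC hact hboxm hbox hVm hVB h324a h324c hCac hk hκ₀ hr₀ hR₁ hrem hRret hblocks hG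
    (fun h => bound25_real_of_chart (T := (B.withSeries 𝔖 Cp).tower3.toTowerRun) (𝔖 k).Ψ chart (𝔖 k).Bcfg bound28
      small28 h)

/-- **C4 `cumulantLower` AT `seriesPieces` — CHART FORM** (same inputs). [cite: Balaban1985UV3, (25) p.262 + (37) p.265 + (59) p.270] -/
theorem cumulantLower_series_chart (B : TowerBase S G) (𝔖 : ∀ k, StepSeries S G V (Nc k) k) (Cp : ∀ k, PiecesParams S k) (k : ℕ)
    [DecidableEq (tsys 3 (𝔖 k).Nblk).Dom] [IsProbabilityMeasure (𝔖 k).μ] {κ C ρ s : ℝ}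
    (hκ : kappa₀ (4 * 2 ^ 3) (2 * 3) + 1 ≤ κ) (hC : 0 ≤ C) {C₂₃ c M₁ δ₀ : ℝ}
    (hact : ∀ h X U, ((𝔖 k).Gt h).activities.act X U = (𝔖 k).act h X U)
    (hboxm : ∀ h, MeasurableSet ((𝔖 k).box h)) (hbox : ∀ h, (𝔖 k).μ ((𝔖 k).box h) ≠ 0)
    (hVm : ∀ h U, AEMeasurable ((𝔖 k).𝒱 h U) (𝔖 k).μ) {Bv : ℝ}
    (hVB : ∀ h U, ∀ ω ∈ (𝔖 k).box h, |(𝔖 k).𝒱 h U ω| ≤ Bv) {nbar : ℕ} {Ca Cc : ℝ}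
    (h324a : ∀ h (U : GaugeField S.P (k + 1) G), |Real.log ((𝔖 k).μ.real ((𝔖 k).box h))| ≤
      Ca * ((L : ℝ) ^ k * S.g0sq) ^ (3 + B.κ₀) * S.sites k)
    (h324c : ∀ h U, ∀ t ∈ Set.Icc (0 : ℝ) 1, |iteratedDeriv (nbar + 1) (ProbabilityTheory.cgf ((𝔖 k).𝒱 h U)
        (chiMeasure (𝔖 k).μ (((𝔖 k).box h).indicator fun _ => (1 : ℝ)))) t| ≤
          Cc * ((nbar + 1)! : ℝ) * ((L : ℝ) ^ k * S.g0sq) ^ (3 + B.κ₀) * S.sites k)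
    (hCac : 0 ≤ Ca + Cc) (hk : k ≤ S.K) (hκ₀ : 0 < B.κ₀) {r₀ R₁ : ℝ} (hr₀ : 1 ≤ r₀) (hR₁ : 6 + 2 * B.κ₀ ≤ R₁)
    (hrem : (Cp k).rem = ((L : ℝ) ^ k * S.g0sq) ^ (3 + B.κ₀) * S.sites k)
    (hRret : B.Rret k = R₁ * B10.rFun r₀ (S.gk k))
    (hblocks : ((𝔖 k).Nblk : ℝ) ^ 3 ≤ S.sites k)
    (hG : ∀ h, GraphRep23AsCited ((𝔖 k).Gt h) (fun U => ∑ n ∈ Finset.Icc 1 nbar, (𝔖 k).cum h U n / (n ! : ℝ))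
      C₂₃ c M₁ δ₀)
    (chart : ∀ X, ChartAnalyticityAsCited ((𝔖 k).Ψ X) ρ (C * S.gk k * Real.exp (-(κ * (tsys 3 (𝔖 k).Nblk).dj X))))
    (bound28 : ∀ X h U, ‖(𝔖 k).Bcfg X h U‖ ≤ s) (small28 : s ≤ ρ / 4) :
    CumulantLower (seriesPieces B 𝔖 Cp k) (0 + C * K₀ (4 * 2 ^ 3) (2 * 3) * Real.exp (-R₁) + (Ca + 0 + Cc)) :=
  cumulantLower_series_std B 𝔖 Cp k hκ hC hact hboxm hbox hVm hVB h324a h324c hCac hk hκ₀ hr₀ hR₁ hrem hRret hblocks hG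
    (fun h => bound25_real_of_chart (T := (B.withSeries 𝔖 Cp).tower3.toTowerRun) (𝔖 k).Ψ chart (𝔖 k).Bcfg bound28
      small28 h)

/-- **B21 `PprT_le` AT `seriesPieces` — CHART FORM**: the vacuum activities `Re Ψ_X(0)` obey (25) by the chart binder at the
origin (as in p6's `vacuumWhole_series`). [cite: Balaban1985UV3, (25) p.262 + (62) p.271] -/
theorem pprT_le_series_chart (B : TowerBase S G) (𝔖 : ∀ k, StepSeries S G V (Nc k) k) (Cp : ∀ k, PiecesParams S k) (k : ℕ)
    [DecidableEq (tsys 3 (𝔖 k).Nblk).Dom] {κ C ρ : ℝ} (hκ : kappa₀ (4 * 2 ^ 3) (2 * 3) ≤ κ) (hC : 0 ≤ C) (hk : k ≤ S.K)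
    (U₁ : GaugeField S.P (k + 1) G)
    (chart : ∀ X, ChartAnalyticityAsCited ((𝔖 k).Ψ X) ρ (C * S.gk k * Real.exp (-(κ * (tsys 3 (𝔖 k).Nblk).dj X))))
    (hblocks : (((𝔖 k).Nblk : ℝ) ^ 3) ≤ S.sites k) :
    |(seriesPieces B 𝔖 Cp k).PprT| ≤ (C * K₀ (4 * 2 ^ 3) (2 * 3)) * S.sites k := by
  refine pprT_le_series_std B 𝔖 Cp k hκ hC hk U₁ (fun X _ => ?_) hblocks
  have hρ : 0 < ρ := (chart X).1
  exact (Complex.abs_re_le_norm _).trans ((chart X).2.2 0 (Metric.mem_closedBall_self (by positivity)))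

end Summit.QuantumFields.Balaban3D.Proofs
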